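import Literature.NumberTheory.Sieve.FriableMoebiusRootSumPrimeSums
import Literature.NumberTheory.Sieve.BuchstabFunction
import Literature.NumberTheory.Transcendental.MahlerManinEndgame
import HarnessLib

/-!
# Prime sums of the Buchstab iteration for the friable Möbius–root sum, II: the main sum

Topic `Literature/NumberTheory/Sieve` (sequel to `FriableMoebiusRootSumPrimeSums.lean`). Everything
here is PROVED; no definitions, no named facts. With prime weights `r` subject to Mertens' second
theorem with rate (`|∑_{p ≤ t} r(p)/p − (log log t + b₀)| ≤ C_E/log² t`), Buchstab's function `ω`
(`buchstabOmega`), `k ≥ 2`, `u = log x/log y ∈ [k, k + 1]`, `z = x^{1/k}` and the Buchstab range of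
primes `y ≤ p < z` realised as `⌊a⌋ < p ≤ ⌊b⌋` (`e ≤ a ≤ y ≤ a + 1`, `a ≤ b < z ≤ b + 1`):

* `abs_sum_prime_buchstabWeight_sub_main_le_of_three_le` — for `k ≥ 3`:
  `|∑_p (r(p)/p) ω(log x/log p − 1)/log p − (u ω(u) − k ω(k))/log x| ≤ K/log² a`,
  `K = (2 + (k + 3)³) C_E + 4 + 4k` (the case `k = 2` and the combined statement are in
  `FriableMoebiusRootSumMainSumTwo.lean`);
* `mul_buchstabOmega_sub_mem` (`t ω(t)` is non-decreasing and `1`-Lipschitz on `[2, ∞)`),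
  `integral_buchstabOmega_inv_sub_one` (the substitution `σ = 1/v`).

This is the `ρ`-weighted analogue of the tree's `abs_sum_buchstabWeight_sub_main_le`
(`RoughNumbersBuchstabMainSum.lean`, weights `log p` through `ϑ`); here the summation is Abel
summation against `log log` (`FriableMoebiusRoot.abs_primeSum_sub_integral_le`) with the weight
`G(v) = ω(1/v − 1)/(v log x)` for `k ≥ 3` (where `1/v − 1 > 2` and `ω` is `C¹`) and
`G(v) = 1/(log x (1 − v))` for `k = 2` (where `ω(s) = 1/s`), and the main term is the substitution
`σ = 1/v` followed by `∫_k^u ω(σ − 1) dσ = u ω(u) − k ω(k)`.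

## References

* G. Tenenbaum, *Introduction to analytic and probabilistic number theory*, 3rd ed., AMS 2015,
  Ch. III.6 (Buchstab's function and iteration). [Tenenbaum2015]
* H. Iwaniec, Invent. Math. 47 (1978), p. 186 (partial summation against `log log`).
  [IwaniecInventiones1978]
-/

open Finset Real MeasureTheory Set intervalIntegral

noncomputable section

namespace Literature.NumberTheory.Sieve

namespace FriableMoebiusRoot

/-! ### Auxiliary facts -/

/-- `t ↦ t ω(t)` is `1`-Lipschitz and non-decreasing on `[2, ∞)`:
`0 ≤ t ω(t) − s ω(s) ≤ t − s` for `2 ≤ s ≤ t` (`(t ω(t))' = ω(t − 1) ∈ [0, 1]`).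
[cite: Tenenbaum2015, Ch. III.6] -/
theorem mul_buchstabOmega_sub_mem {s t : ℝ} (hs : 2 ≤ s) (hst : s ≤ t) :
    0 ≤ t * buchstabOmega t - s * buchstabOmega s ∧
      t * buchstabOmega t - s * buchstabOmega s ≤ t - s := by
  rw [mul_buchstabOmega_sub_eq_integral hs hst]
  constructor
  · exact intervalIntegral.integral_nonneg hst fun τ _ => buchstabOmega_nonneg _
  · have h := intervalIntegral.norm_integral_le_of_norm_le_const (a := s) (b := t) (C := 1)
      (f := fun τ => buchstabOmega (τ - 1)) fun τ _ => by
        rw [Real.norm_eq_abs]; exact abs_buchstabOmega_le_one _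
    rw [Real.norm_eq_abs, abs_of_nonneg (sub_nonneg.mpr hst), one_mul] at h
    exact (le_abs_self _).trans h

/-- **The substitution `σ = 1/v`**: for `0 < α ≤ β` with `2 ≤ 1/β`,
`∫_α^β ω(1/v − 1) v⁻² dv = (1/α) ω(1/α) − (1/β) ω(1/β)`. [cite: Tenenbaum2015, Ch. III.6] -/
theorem integral_buchstabOmega_inv_sub_one {α β : ℝ} (hα : 0 < α) (hαβ : α ≤ β) (hβ : 2 ≤ 1 / β) :
    ∫ v in α..β, buchstabOmega (1 / v - 1) / v ^ 2 =
      (1 / α) * buchstabOmega (1 / α) - (1 / β) * buchstabOmega (1 / β) := by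
  have hβ0 : 0 < β := hα.trans_le hαβ
  have huIcc : Set.uIcc α β = Set.Icc α β := Set.uIcc_of_le hαβ
  have hvpos : ∀ v ∈ Set.uIcc α β, 0 < v := fun v hv => by rw [huIcc] at hv; exact hα.trans_le hv.1
  -- `f(v) = 1/v`, `f'(v) = −1/v²`, `g(σ) = ω(σ − 1)`
  have hf : ∀ v ∈ Set.uIcc α β, HasDerivAt (fun v : ℝ => 1 / v) (-(1 / v ^ 2)) v := by
    intro v hv
    have hv0 := hvpos v hv
    have h := (hasDerivAt_id v).fun_inv hv0.ne'
    simp only [id] at h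
    refine (h.congr_of_eventuallyEq (Filter.Eventually.of_forall fun s => ?_)).congr_deriv ?_
    · simp only [one_div]
    · field_simp
  have hf' : ContinuousOn (fun v : ℝ => -(1 / v ^ 2)) (Set.uIcc α β) :=
    (continuousOn_const.div (continuousOn_id.pow 2) fun v hv => (pow_pos (hvpos v hv) 2).ne').neg
  have hg : ContinuousOn (fun σ : ℝ => buchstabOmega (σ - 1)) ((fun v : ℝ => 1 / v) '' Set.uIcc α β) := by
    refine continuousOn_buchstabOmega_sub_one.mono ?_
    rintro σ ⟨v, hv, rfl⟩
    rw [huIcc] at hv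
    have hv0 : 0 < v := hα.trans_le hv.1
    have h1 : 1 / β ≤ 1 / v := one_div_le_one_div_of_le hv0 hv.2
    exact Set.mem_Ici.mpr (hβ.trans h1)
  have h := intervalIntegral.integral_comp_mul_deriv' hf hf' hg
  -- `∫_α^β ω(1/v − 1)(−1/v²) dv = ∫_{1/α}^{1/β} ω(σ − 1) dσ = −((1/α)ω(1/α) − (1/β)ω(1/β))`
  have hαβ' : 1 / β ≤ 1 / α := one_div_le_one_div_of_le hα hαβ
  rw [intervalIntegral.integral_symm (1 / β) (1 / α), ← mul_buchstabOmega_sub_eq_integral hβ hαβ'] at h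
  have h2 : ∫ v in α..β, buchstabOmega (1 / v - 1) / v ^ 2 =
      -∫ v in α..β, ((fun σ : ℝ => buchstabOmega (σ - 1)) ∘ fun v : ℝ => 1 / v) v * -(1 / v ^ 2) := by
    rw [← intervalIntegral.integral_neg]
    refine intervalIntegral.integral_congr fun v _ => ?_
    simp only [Function.comp]
    ring
  rw [h2, h]
  ring

/-! ### The main sum, `k ≥ 3` -/

/-- **The main prime sum, case `k ≥ 3`.** With the Buchstab-range hypotheses of
`abs_sum_prime_buchstabWeight_sub_main_le` and `3 ≤ k`:
`|∑_p (r(p)/p) ω(log x/log p − 1)/log p − (u ω(u) − k ω(k))/log x| ≤ ((2 + (k+3)³) C_E + 4 + 4k)/log² a`.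
[cite: Tenenbaum2015, Ch. III.6] -/
theorem abs_sum_prime_buchstabWeight_sub_main_le_of_three_le {r : ℕ → ℝ} {b₀ CE : ℝ}
    (hM : ∀ t : ℝ, 2 ≤ t → |∑ p ∈ Nat.primesLE ⌊t⌋₊, r p / p - (Real.log (Real.log t) + b₀)| ≤
      CE / Real.log t ^ 2)
    {k : ℕ} (hk : 3 ≤ k) {x y z a b : ℝ} (ha : Real.exp 1 ≤ a) (hay : a ≤ y) (hya : y ≤ a + 1)
    (hab : a ≤ b) (hbz : b < z) (hzb : z ≤ b + 1) (hx : 0 < x) (hz : Real.log z = Real.log x / k)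
    (hu : (k : ℝ) ≤ Real.log x / Real.log y) (hxa : Real.log x ≤ 2 * (k + 1) * Real.log a) :
    |∑ p ∈ (Finset.Ioc ⌊a⌋₊ ⌊b⌋₊).filter Nat.Prime,
        r p / p * (buchstabOmega (Real.log x / Real.log p - 1) / Real.log p) -
      1 / Real.log x * (Real.log x / Real.log y * buchstabOmega (Real.log x / Real.log y) -
        k * buchstabOmega k)| ≤ ((2 + (k + 3) ^ 3) * CE + 4 + 4 * k) / Real.log a ^ 2 := by
  set L := Real.log x with hL
  set α := Real.log a / L with hα
  set β := Real.log b / L with hβ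
  -- numerics
  have hCE : 0 ≤ CE := mertensConst_nonneg hM
  have hk3 : (3 : ℝ) ≤ k := by exact_mod_cast hk
  have ha0 : 0 < a := (Real.exp_pos 1).trans_le ha
  have hla1 : 1 ≤ Real.log a := by rw [Real.le_log_iff_exp_le ha0]; exact ha
  have hla : 0 < Real.log a := by linarith
  have hy0 : 0 < y := ha0.trans_le hay
  have hb0 : 0 < b := ha0.trans_le hab
  have hz0 : 0 < z := hb0.trans hbz
  have hlay : Real.log a ≤ Real.log y := Real.log_le_log ha0 hay
  have hlab : Real.log a ≤ Real.log b := Real.log_le_log ha0 hab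
  have hly : 0 < Real.log y := by linarith
  have hlb : 0 < Real.log b := by linarith
  have hLy : (k : ℝ) * Real.log y ≤ L := by rwa [le_div_iff₀ hly] at hu
  have hL3 : 3 ≤ L := le_trans (by nlinarith) hLy
  have hL0 : 0 < L := by linarith
  have hlbz : Real.log b < Real.log z := Real.log_lt_log hb0 hbz
  have hlz0 : 0 < Real.log z := hlb.trans hlbz
  have hkz : (k : ℝ) = L / Real.log z := by rw [hz]; field_simp
  have hbx : b < x := by
    have h1 : Real.log b < L := by
      calc Real.log b < Real.log z := hlbz
        _ = L / k := hz
        _ ≤ L / 1 := div_le_div_of_nonneg_left hL0.le one_pos (by linarith)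
        _ = L := div_one L
    by_contra h
    push Not at h
    linarith [Real.log_le_log hx h]
  have ha2 : 2 ≤ a := le_trans (by have := Real.add_one_le_exp (1 : ℝ); linarith) ha
  have hα0 : 0 < α := div_pos hla hL0
  have hαβ : α ≤ β := div_le_div_of_nonneg_right hlab hL0.le
  have hβ0 : 0 < β := hα0.trans_le hαβ
  have hαL : α * L = Real.log a := by simp only [hα]; field_simp
  have hβL : β * L = Real.log b := by simp only [hβ]; field_simp
  have hinvα : 1 / α = L / Real.log a := by simp only [hα]; rw [one_div_div]
  have hinvβ : 1 / β = L / Real.log b := by simp only [hβ]; rw [one_div_div]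
  have hβk : (k : ℝ) < 1 / β := by
    rw [hinvβ, hkz]; exact div_lt_div_of_pos_left hL0 hlb hlbz
  have hβ2 : 2 < 1 / β := by linarith
  have hαk : 1 / α ≤ 2 * (k + 1) := by rw [hinvα, div_le_iff₀ hla]; linarith
  have hs : ∀ v ∈ Set.Icc α β, 0 < v ∧ 2 < 1 / v - 1 := by
    intro v hv
    have hv0 : 0 < v := hα0.trans_le hv.1
    have : 1 / β ≤ 1 / v := one_div_le_one_div_of_le hv0 hv.2
    exact ⟨hv0, by linarith⟩
  -- the weight and its derivative
  set Dω : ℝ → ℝ := fun s => (buchstabOmega (s - 1) - buchstabOmega s) / s with hDω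
  set G : ℝ → ℝ := fun v => buchstabOmega (1 / v - 1) / (v * L) with hG
  set G' : ℝ → ℝ := fun v => -(Dω (1 / v - 1) / v + buchstabOmega (1 / v - 1)) / (v ^ 2 * L)
    with hG'
  have hGd : ∀ v ∈ Set.Icc α β, HasDerivAt G (G' v) v := by
    intro v hv
    obtain ⟨hv0, hsv⟩ := hs v hv
    have h1 : HasDerivAt (fun v : ℝ => 1 / v - 1) (-(1 / v ^ 2)) v := by
      have h := ((hasDerivAt_id v).fun_inv hv0.ne').sub_const 1
      simp only [id] at h
      refine (h.congr_of_eventuallyEq (Filter.Eventually.of_forall fun s => ?_)).congr_deriv ?_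
      · simp only [one_div]
      · field_simp
    have h2 : HasDerivAt buchstabOmega (Dω (1 / v - 1)) (1 / v - 1) := hasDerivAt_buchstabOmega hsv
    have h3 := h2.comp v h1
    have h4 : HasDerivAt (fun v : ℝ => (v * L)⁻¹) (-(1 * L) / (v * L) ^ 2) v :=
      ((hasDerivAt_id v).mul_const L).fun_inv (by positivity)
    have h5 := h3.mul h4
    have h6 : HasDerivAt G (Dω (1 / v - 1) * -(1 / v ^ 2) * (v * L)⁻¹ +
        buchstabOmega (1 / v - 1) * (-(1 * L) / (v * L) ^ 2)) v := by
      refine h5.congr_of_eventuallyEq (Filter.Eventually.of_forall fun s => ?_)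
      simp only [hG, Function.comp, div_eq_mul_inv, Pi.mul_apply]
    refine h6.congr_deriv ?_
    simp only [hG']
    field_simp
    ring
  have hsc : ContinuousOn (fun v : ℝ => 1 / v - 1) (Set.Icc α β) :=
    (continuousOn_const.div continuousOn_id fun v hv => (hs v hv).1.ne').sub continuousOn_const
  have hG'c : ContinuousOn G' (Set.Icc α β) := by
    have h1 : ContinuousOn (fun v => Dω (1 / v - 1)) (Set.Icc α β) :=
      continuousOn_deriv_buchstabOmega.comp hsc fun v hv => Set.mem_Ioi.mpr (hs v hv).2
    have h2 : ContinuousOn (fun v => buchstabOmega (1 / v - 1)) (Set.Icc α β) :=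
      continuousOn_buchstabOmega.comp hsc fun v hv => Set.mem_Ici.mpr (by linarith [(hs v hv).2])
    simp only [hG']
    refine ContinuousOn.div ((h1.div continuousOn_id fun v hv => (hs v hv).1.ne').add h2).neg
      ((continuousOn_id.pow 2).mul continuousOn_const) fun v hv => ?_
    have := (hs v hv).1
    positivity
  have hwrap := abs_primeSum_sub_integral_le hM ha2 hab hbx hGd hG'c
  -- the sum is the prime sum of the statement
  have hsum : ∑ p ∈ (Finset.Ioc ⌊a⌋₊ ⌊b⌋₊).filter Nat.Prime, r p / p * G (Real.log p / L) =
      ∑ p ∈ (Finset.Ioc ⌊a⌋₊ ⌊b⌋₊).filter Nat.Prime,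
        r p / p * (buchstabOmega (L / Real.log p - 1) / Real.log p) := by
    refine Finset.sum_congr rfl fun p hp => ?_
    have hp2 : 2 ≤ p := (Finset.mem_filter.mp hp).2.two_le
    have hlp : 0 < Real.log p := Real.log_pos (by exact_mod_cast (by omega : 1 < p))
    simp only [hG]
    rw [one_div_div, div_mul_cancel₀ _ hL0.ne']
  rw [hsum] at hwrap
  -- the main integral `∫_α^β G/v = ((1/α)ω(1/α) − (1/β)ω(1/β))/L`
  have hmain : ∫ v in α..β, G v / v =
      1 / L * ((1 / α) * buchstabOmega (1 / α) - (1 / β) * buchstabOmega (1 / β)) := by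
    rw [← integral_buchstabOmega_inv_sub_one hα0 hαβ hβ2.le, ← intervalIntegral.integral_const_mul]
    refine intervalIntegral.integral_congr fun v hv => ?_
    rw [Set.uIcc_of_le hαβ] at hv
    have hv0 := (hs v hv).1
    simp only [hG]
    field_simp
  -- `(1/α)ω(1/α)` vs `uω(u)` and `(1/β)ω(1/β)` vs `kω(k)` (Lipschitz, endpoints within `1/a`)
  set u := L / Real.log y with hu_def
  have hu2 : 2 ≤ u := by linarith
  have hk2 : (2 : ℝ) ≤ k := by linarith
  have huα : u ≤ 1 / α := by rw [hinvα]; exact div_le_div_of_nonneg_left hL0.le hla hlay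
  have hya' : Real.log y - Real.log a ≤ 1 / a := by
    rw [← Real.log_div hy0.ne' ha0.ne']
    have := Real.log_le_sub_one_of_pos (div_pos hy0 ha0)
    have h2 : y / a - 1 ≤ 1 / a := by rw [div_sub_one ha0.ne', div_le_div_iff_of_pos_right ha0]; linarith
    linarith
  have hzb' : Real.log z - Real.log b ≤ 1 / a := by
    rw [← Real.log_div hz0.ne' hb0.ne']
    have := Real.log_le_sub_one_of_pos (div_pos hz0 hb0)
    have h2 : z / b - 1 ≤ 1 / a := by
      rw [div_sub_one hb0.ne']
      calc (z - b) / b ≤ 1 / b := by rw [div_le_div_iff_of_pos_right hb0]; linarith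
        _ ≤ 1 / a := one_div_le_one_div_of_le ha0 hab
    linarith
  have ha4 : 1 / a ≤ 4 / Real.log a ^ 2 := by
    rw [div_le_div_iff₀ ha0 (by positivity), one_mul]
    exact Literature.NumberTheory.Transcendental.log_sq_le_four_mul (by linarith)
  have hE1 : |1 / L * ((1 / α) * buchstabOmega (1 / α)) - 1 / L * (u * buchstabOmega u)| ≤
      4 / Real.log a ^ 2 := by
    rw [← mul_sub, abs_mul, abs_of_pos (by positivity : 0 < 1 / L)]
    obtain ⟨h0, h1⟩ := mul_buchstabOmega_sub_mem hu2 huα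
    rw [abs_of_nonneg h0]
    have h2 : 1 / α - u = L * (Real.log y - Real.log a) / (Real.log a * Real.log y) := by
      rw [hinvα, hu_def]; field_simp
    have h3 : 1 / L * (1 / α - u) ≤ 1 / a := by
      rw [h2]
      calc 1 / L * (L * (Real.log y - Real.log a) / (Real.log a * Real.log y))
          = (Real.log y - Real.log a) / (Real.log a * Real.log y) := by field_simp
        _ ≤ (1 / a) / (1 * 1) := by
            refine div_le_div₀ (by positivity) hya' (by norm_num) ?_
            exact mul_le_mul hla1 (by linarith) zero_le_one hla.le
        _ = 1 / a := by ring
    calc 1 / L * (1 / α * buchstabOmega (1 / α) - u * buchstabOmega u) ≤ 1 / L * (1 / α - u) :=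
          mul_le_mul_of_nonneg_left h1 (by positivity)
      _ ≤ 4 / Real.log a ^ 2 := h3.trans ha4
  have hE2 : |1 / L * ((1 / β) * buchstabOmega (1 / β)) - 1 / L * (k * buchstabOmega k)| ≤
      4 * k / Real.log a ^ 2 := by
    rw [← mul_sub, abs_mul, abs_of_pos (one_div_pos.mpr hL0)]
    obtain ⟨h0, h1⟩ := mul_buchstabOmega_sub_mem hk2 hβk.le
    rw [abs_of_nonneg h0]
    have hkz' : L / Real.log z = k := hkz.symm
    have h2 : 1 / L * (1 / β - k) = (Real.log z - Real.log b) / (Real.log b * Real.log z) := by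
      rw [hinvβ, ← hkz']
      field_simp
    have e1 : (Real.log z - Real.log b) / (Real.log b * Real.log z) ≤ (1 / a) / Real.log z := by
      rw [div_le_div_iff₀ (by positivity) hlz0]
      calc (Real.log z - Real.log b) * Real.log z ≤ (1 / a) * Real.log z :=
            mul_le_mul_of_nonneg_right hzb' hlz0.le
        _ ≤ (1 / a) * (Real.log b * Real.log z) :=
            mul_le_mul_of_nonneg_left (le_mul_of_one_le_left hlz0.le (by linarith)) (by positivity)
    have e2 : (1 / a) / Real.log z = (1 / a) * (k / L) := by rw [hz]; field_simp
    have e3 : (k : ℝ) / L ≤ k := by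
      rw [div_le_iff₀ hL0]
      exact le_mul_of_one_le_right (by positivity) (by linarith)
    calc 1 / L * (1 / β * buchstabOmega (1 / β) - k * buchstabOmega k) ≤ 1 / L * (1 / β - k) :=
          mul_le_mul_of_nonneg_left h1 (by positivity)
      _ = (Real.log z - Real.log b) / (Real.log b * Real.log z) := h2
      _ ≤ (1 / a) / Real.log z := e1
      _ = (1 / a) * (k / L) := e2
      _ ≤ (1 / a) * k := mul_le_mul_of_nonneg_left e3 (by positivity)
      _ ≤ (4 / Real.log a ^ 2) * k := mul_le_mul_of_nonneg_right ha4 (by positivity)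
      _ = 4 * k / Real.log a ^ 2 := by ring
  -- the error factor `|G α| + |G β| + ∫|G'| ≤ 2 + (k+3)³`
  have hGb : ∀ v ∈ Set.Icc α β, |G v| ≤ 1 := by
    intro v hv
    have hv0 := (hs v hv).1
    have hvL : Real.log a ≤ v * L := by rw [← hαL]; exact mul_le_mul_of_nonneg_right hv.1 hL0.le
    simp only [hG]
    rw [abs_div, abs_of_nonneg (buchstabOmega_nonneg _), abs_of_pos (by positivity)]
    calc buchstabOmega (1 / v - 1) / (v * L) ≤ 1 / (v * L) :=
          div_le_div_of_nonneg_right (buchstabOmega_le_one _) (by positivity)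
      _ ≤ 1 / 1 := div_le_div_of_nonneg_left zero_le_one one_pos (by linarith)
      _ = 1 := by norm_num
  set M : ℝ := (1 / (4 * α) + 1) / (α ^ 2 * L) with hMdef
  have hG'b : ∀ v ∈ Set.Icc α β, |G' v| ≤ M := by
    intro v hv
    obtain ⟨hv0, hsv⟩ := hs v hv
    have hD : |Dω (1 / v - 1)| ≤ 1 / 4 := abs_deriv_buchstabOmega_le hsv
    have hω : |buchstabOmega (1 / v - 1)| ≤ 1 := abs_buchstabOmega_le_one _
    simp only [hG']
    rw [abs_div, abs_neg, abs_of_pos (by positivity : 0 < v ^ 2 * L)]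
    have hnum : |Dω (1 / v - 1) / v + buchstabOmega (1 / v - 1)| ≤ 1 / (4 * α) + 1 := by
      refine (abs_add_le _ _).trans (add_le_add ?_ hω)
      rw [abs_div, abs_of_pos hv0]
      calc |Dω (1 / v - 1)| / v ≤ (1 / 4) / α := div_le_div₀ (by norm_num) hD hα0 hv.1
        _ = 1 / (4 * α) := by rw [div_div]
    calc |Dω (1 / v - 1) / v + buchstabOmega (1 / v - 1)| / (v ^ 2 * L)
        ≤ (1 / (4 * α) + 1) / (v ^ 2 * L) := div_le_div_of_nonneg_right hnum (by positivity)
      _ ≤ (1 / (4 * α) + 1) / (α ^ 2 * L) := by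
          refine div_le_div_of_nonneg_left (by positivity) (by positivity) ?_
          exact mul_le_mul_of_nonneg_right (pow_le_pow_left₀ hα0.le hv.1 2) hL0.le
  have hIG' : ∫ v in α..β, |G' v| ≤ (k + 3) ^ 3 := by
    have h1 : ∫ v in α..β, |G' v| ≤ ∫ v in α..β, M := by
      refine intervalIntegral.integral_mono_on hαβ ?_ ?_ hG'b
      · exact ((continuous_abs.comp_continuousOn hG'c).intervalIntegrable_of_Icc hαβ)
      · exact intervalIntegrable_const
    rw [intervalIntegral.integral_const, smul_eq_mul] at h1
    have hβk' : β ≤ 1 / 3 :=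
      ((lt_one_div (by norm_num : (0:ℝ) < 3) hβ0).mp (by linarith)).le
    have hM0 : 0 ≤ M := by positivity
    have hA0 : 0 ≤ 1 / α := by positivity
    have hM1 : M ≤ (2 * (k + 1) / 4 + 1) * (2 * (k + 1)) ^ 2 * (1 / 3) := by
      have e0 : M = (1 / α / 4 + 1) * (1 / α) ^ 2 * (1 / L) := by
        simp only [hMdef]; field_simp
      rw [e0]
      refine mul_le_mul (mul_le_mul (by linarith) (pow_le_pow_left₀ hA0 hαk 2) (by positivity)
        (by positivity)) (one_div_le_one_div_of_le (by norm_num) hL3) (by positivity) (by positivity)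
    have hk0 : (0 : ℝ) ≤ k + 3 := add_nonneg (Nat.cast_nonneg k) (by norm_num)
    have hkk : ((k : ℝ) + 1) ^ 2 ≤ ((k : ℝ) + 3) ^ 2 :=
      pow_le_pow_left₀ (add_nonneg (Nat.cast_nonneg k) zero_le_one) (by linarith) 2
    calc ∫ v in α..β, |G' v| ≤ (β - α) * M := h1
      _ ≤ (1 / 3) * ((2 * (k + 1) / 4 + 1) * (2 * (k + 1)) ^ 2 * (1 / 3)) :=
          mul_le_mul (by linarith) hM1 hM0 (by norm_num)
      _ = (2 / 9) * ((k + 3) * (k + 1) ^ 2) := by ring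
      _ ≤ 1 * ((k + 3) * (k + 3) ^ 2) :=
          mul_le_mul (by norm_num) (mul_le_mul_of_nonneg_left hkk hk0) (by positivity) zero_le_one
      _ = (k + 3) ^ 3 := by ring
  have hfac : (|G α| + |G β| + ∫ v in α..β, |G' v|) * (CE / Real.log a ^ 2) ≤
      (2 + (k + 3) ^ 3) * CE / Real.log a ^ 2 := by
    have h3 : |G α| + |G β| + ∫ v in α..β, |G' v| ≤ 2 + (k + 3) ^ 3 := by
      linarith [hGb α ⟨le_rfl, hαβ⟩, hGb β ⟨hαβ, le_rfl⟩]
    calc _ ≤ (2 + (k + 3) ^ 3) * (CE / Real.log a ^ 2) := mul_le_mul_of_nonneg_right h3 (by positivity)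
      _ = _ := by ring
  -- assemble
  have hw := hwrap.trans hfac
  rw [hmain] at hw
  have hsplit : 1 / L * (1 / α * buchstabOmega (1 / α) - 1 / β * buchstabOmega (1 / β)) -
      1 / L * (u * buchstabOmega u - k * buchstabOmega k) =
      (1 / L * (1 / α * buchstabOmega (1 / α)) - 1 / L * (u * buchstabOmega u)) -
        (1 / L * (1 / β * buchstabOmega (1 / β)) - 1 / L * (k * buchstabOmega k)) := by ring
  have htot := abs_sub_le
    (∑ p ∈ (Finset.Ioc ⌊a⌋₊ ⌊b⌋₊).filter Nat.Prime, r p / p * (buchstabOmega (L / Real.log p - 1) / Real.log p))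
    (1 / L * (1 / α * buchstabOmega (1 / α) - 1 / β * buchstabOmega (1 / β)))
    (1 / L * (u * buchstabOmega u - k * buchstabOmega k))
  rw [hsplit] at htot
  have h4 := abs_sub (1 / L * (1 / α * buchstabOmega (1 / α)) - 1 / L * (u * buchstabOmega u))
    (1 / L * (1 / β * buchstabOmega (1 / β)) - 1 / L * (k * buchstabOmega k))
  calc _ ≤ (2 + (k + 3) ^ 3) * CE / Real.log a ^ 2 + (4 / Real.log a ^ 2 + 4 * k / Real.log a ^ 2) := by
        linarith
    _ = ((2 + (k + 3) ^ 3) * CE + 4 + 4 * k) / Real.log a ^ 2 := by ring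

end FriableMoebiusRoot

end Literature.NumberTheory.Sieve
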